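import Literature.Computability.MetaComplexity.GaussianWidthDepthFregeRows
import HarnessLib

/-!
# Gaussian width and bounded-depth Frege, II: the chain along a Gaussian derivation

Third layer of the bounded-depth Frege UPPER bound through Gaussian width
(`GaussianWidthDepthFregeUpperBound.lean`). Given a Gaussian derivation
`L : Fin (t+1) → LinEqMod 2 n` from `E : Fin m → LinEqMod 2 n` (`IsGaussianDerivation`,
`GaussianWidth.lean`) all of whose lines have `≤ w` variables:

* `rowList E`, `derived E L k`, `state E L k` — the rows, the DISTINCT derived equations among
  the first `k` lines (a line already present — in particular every axiom line — is skipped), and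
  the list `derived ++ rows` whose parity DNFs form the carried conjunction;
  `length_derived_le`: at most `2 (n+1)^w` equations are ever derived (`card_smallEqs_le`);
* `chainS` — **the carried line** `⊢ ⋀ (state k).map parityForm, ¬F` for every `k`, starting
  from the rows (`rowsFoldS`) and paying `stepLines P Q (2w)` lines per genuinely new line
  (`chainLocalS`: the new parity is implied by the parities of the `≤ 2` premise lines, already
  in the conjunction, over their `≤ 2w` variables);
* `refuteS` — for a REFUTATION (last line `0 = 1`, whose parity DNF is `⊥`) the chain ends in a
  bounded derivation of `¬F` itself (`chainFinalS`).

All statements are proved; line counts are explicit.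

References: E. Ben-Sasson, R. Impagliazzo, Comput. Complexity 19 (2010) (Gaussian width);
P. Clote, E. Kranakis, *Boolean Functions and Computation Models* (2002), §5.5.3 (the Gaussian
calculus); N. Galesi, D. Itsykson, A. Riazanov, A. Sofronova, APAL 174 (2023), §4.
-/

namespace Literature.Computability.MetaComplexity

open Complexity Complexity.PropForm TextbookFrege KrajicekRamsey Finset

namespace GaussFrege

/-! ### Variable lists of supports -/

section VarList

variable {n : ℕ}

/-- The increasing list of the indices of a set of variables. [folklore] -/
def varList (S : Finset (Fin n)) : List ℕ :=
  (S.sort (· ≤ ·)).map fun i : Fin n => (i : ℕ)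

/-- `varList` is duplicate-free. [folklore] -/
theorem nodup_varList (S : Finset (Fin n)) : (varList S).Nodup :=
  (Finset.sort_nodup _ _).map Fin.val_injective

/-- `varList S` has `|S|` members. [folklore] -/
theorem length_varList (S : Finset (Fin n)) : (varList S).length = S.card := by
  rw [varList, List.length_map, Finset.length_sort]

/-- Membership in `varList`. [folklore] -/
theorem mem_varList {S : Finset (Fin n)} {x : ℕ} : x ∈ varList S ↔ ∃ i ∈ S, (i : ℕ) = x := by
  simp [varList]

/-- The variables of a parity DNF lie in the variable list of any superset of the support.
[folklore] -/
theorem mem_varList_of_mem_vars_parityForm {q : LinEqMod 2 n} {S : Finset (Fin n)}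
    (hS : q.supp ⊆ S) {x : ℕ} (hx : x ∈ (parityForm q).vars) : x ∈ varList S := by
  obtain ⟨i, hi, rfl⟩ := mem_eqVars_one.1 (mem_vars_parityForm hx)
  exact mem_varList.2 ⟨i, hS hi, rfl⟩

end VarList

/-! ### The deduplicated state along a derivation -/

section State

variable {m n t : ℕ} (E : Fin m → LinEqMod 2 n) (L : Fin (t + 1) → LinEqMod 2 n)

/-- The rows of the system, as a list. [folklore] -/
def rowList : List (LinEqMod 2 n) :=
  (List.finRange m).map E

/-- The DISTINCT equations derived among the first `k` lines of `L` (newest first): a line that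
already occurs — among the derived equations or among the rows, so in particular every axiom
line — is skipped ("deduplicate derived equations"). [folklore] -/
def derived : ℕ → List (LinEqMod 2 n)
  | 0 => []
  | k + 1 =>
    if h : k < t + 1 then
      (if L ⟨k, h⟩ ∈ derived k ++ rowList E then derived k else L ⟨k, h⟩ :: derived k)
    else derived k

/-- The state after `k` lines: derived equations, then the rows. Its parity DNFs are the members of
the carried conjunction. [folklore] -/
def state (k : ℕ) : List (LinEqMod 2 n) :=
  derived E L k ++ rowList E

variable {E L}

/-- Membership in the row list. [folklore] -/
theorem mem_rowList {q : LinEqMod 2 n} : q ∈ rowList E ↔ ∃ e, E e = q := by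
  simp [rowList]

/-- The row list has `m` members. [folklore] -/
@[simp] theorem length_rowList : (rowList E).length = m := by
  simp [rowList]

/-- Unfolding `derived` at a skipped line. [folklore] -/
theorem derived_succ_of_mem {k : ℕ} (hk : k < t + 1) (h : L ⟨k, hk⟩ ∈ state E L k) :
    derived E L (k + 1) = derived E L k := by
  rw [state] at h
  simp [derived, hk, h]

/-- Unfolding `derived` at a genuinely new line. [folklore] -/
theorem derived_succ_of_not_mem {k : ℕ} (hk : k < t + 1) (h : L ⟨k, hk⟩ ∉ state E L k) :
    derived E L (k + 1) = L ⟨k, hk⟩ :: derived E L k := by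
  rw [state] at h
  simp [derived, hk, h]

/-- Unfolding `derived` beyond the derivation. [folklore] -/
theorem derived_succ_of_le {k : ℕ} (hk : t + 1 ≤ k) : derived E L (k + 1) = derived E L k := by
  have : ¬ k < t + 1 := by omega
  simp [derived, this]

/-- Derived equations are lines of the derivation. [folklore] -/
theorem exists_eq_of_mem_derived : ∀ {k : ℕ} {q : LinEqMod 2 n}, q ∈ derived E L k → ∃ i, L i = q := by
  intro k
  induction k with
  | zero => intro q h; simp [derived] at h
  | succ k ih =>
    intro q hq
    by_cases hk : k < t + 1
    · by_cases hmem : L ⟨k, hk⟩ ∈ state E L k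
      · rw [derived_succ_of_mem hk hmem] at hq; exact ih hq
      · rw [derived_succ_of_not_mem hk hmem, List.mem_cons] at hq
        rcases hq with rfl | hq
        · exact ⟨_, rfl⟩
        · exact ih hq
    · rw [derived_succ_of_le (by omega)] at hq; exact ih hq

/-- The derived equations are distinct. [folklore] -/
theorem nodup_derived : ∀ k : ℕ, (derived E L k).Nodup := by
  intro k
  induction k with
  | zero => simp [derived]
  | succ k ih =>
    by_cases hk : k < t + 1
    · by_cases hmem : L ⟨k, hk⟩ ∈ state E L k
      · rw [derived_succ_of_mem hk hmem]; exact ih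
      · rw [derived_succ_of_not_mem hk hmem, List.nodup_cons]
        exact ⟨fun h => hmem (List.mem_append_left _ h), ih⟩
    · rw [derived_succ_of_le (by omega)]; exact ih

/-- The state only grows. [folklore] -/
theorem state_subset_succ (k : ℕ) {q : LinEqMod 2 n} (h : q ∈ state E L k) : q ∈ state E L (k + 1) := by
  rw [state, List.mem_append] at h ⊢
  rcases h with h | h
  · left
    by_cases hk : k < t + 1
    · by_cases hmem : L ⟨k, hk⟩ ∈ state E L k
      · rwa [derived_succ_of_mem hk hmem]
      · rw [derived_succ_of_not_mem hk hmem]; exact List.mem_cons_of_mem _ h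
    · rwa [derived_succ_of_le (by omega)]
  · exact Or.inr h

/-- Every processed line belongs to the state. [folklore] -/
theorem line_mem_state : ∀ (k : ℕ) (i : Fin (t + 1)), (i : ℕ) < k → L i ∈ state E L k := by
  intro k
  induction k with
  | zero => intro i hi; exact absurd hi (Nat.not_lt_zero _)
  | succ k ih =>
    intro i hi
    by_cases hik : (i : ℕ) < k
    · exact state_subset_succ k (ih i hik)
    · have hik' : (i : ℕ) = k := by omega
      have hk : k < t + 1 := hik' ▸ i.2
      have hi' : i = ⟨k, hk⟩ := Fin.ext hik'
      subst hi'
      by_cases hmem : L ⟨k, hk⟩ ∈ state E L k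
      · exact state_subset_succ k hmem
      · rw [state, derived_succ_of_not_mem hk hmem]
        exact List.mem_cons_self

/-- Rows belong to every state. [folklore] -/
theorem row_mem_state (k : ℕ) (e : Fin m) : E e ∈ state E L k :=
  List.mem_append_right _ (mem_rowList.2 ⟨e, rfl⟩)

/-- **Few derived equations**: if every line has at most `w` variables, at most `2 (n+1)^w`
equations are ever derived. [folklore] -/
theorem length_derived_le {w : ℕ} (hw : ∀ i, (L i).supp.card ≤ w) (k : ℕ) :
    (derived E L k).length ≤ 2 * (n + 1) ^ w :=
  length_le_of_nodup_of_small (nodup_derived k) fun q hq => by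
    obtain ⟨i, rfl⟩ := exists_eq_of_mem_derived hq
    exact hw i

/-- Supports in the state are small. [folklore] -/
theorem card_supp_le_of_mem_state {w ℓ : ℕ} (hw : ∀ i, (L i).supp.card ≤ w)
    (hE : ∀ e, (E e).supp.card ≤ ℓ) {k : ℕ} {q : LinEqMod 2 n} (hq : q ∈ state E L k) :
    q.supp.card ≤ w + ℓ := by
  rw [state, List.mem_append] at hq
  rcases hq with hq | hq
  · obtain ⟨i, rfl⟩ := exists_eq_of_mem_derived hq
    exact (hw i).trans (Nat.le_add_right _ _)
  · obtain ⟨e, rfl⟩ := mem_rowList.1 hq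
    exact (hE e).trans (Nat.le_add_left _ _)

end State

/-! ### The chain -/

section Chain

variable {D B m n t w ℓ P Q ℓ₀ : ℕ} {E : Fin m → LinEqMod 2 n} {L : Fin (t + 1) → LinEqMod 2 n}

/-- **The carried line along a Gaussian derivation.** Let `L` be a Gaussian derivation from the
`ℓ`-sparse system `E` with all lines of `≤ w` variables, `F = ofCNF (sumEncoding 1 E)`, and
suppose `⊢ ⋀_e parityForm (E e), ¬F` has a bounded derivation with `ℓ₀` lines. Then for every
`k`, `⊢ ⋀_{q ∈ state k} parityForm q, ¬F` has one with `ℓ₀ + |derived k| · stepLines P Q (2w)`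
lines: each genuinely new line `Lᵢ` is a scalar multiple or a sum of earlier lines, whose parity
DNFs are in the conjunction and imply `parityForm Lᵢ` over their `≤ 2w` variables (`chainLocalS`);
axiom lines and repeated lines are already present. [cite: GalesiEtAl2023, §4] -/
theorem chainS (hL : IsGaussianDerivation E L) (hw : ∀ i, (L i).supp.card ≤ w)
    (hE : ∀ e, (E e).supp.card ≤ ℓ) (hP : 2 ^ (w + ℓ) * (3 * (w + ℓ) + 2) + 1 ≤ P)
    (hQ : m + 2 * (n + 1) ^ w + 1 ≤ Q) (hD : 16 ≤ D)
    (hB : 128 * (Q * (P + 1) + 1) + 40 * (2 * w) + 600 ≤ B)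
    (hΦB : 8 * (neg (PropForm.ofCNF (sumEncoding 1 E))).size ≤ B)
    (h0 : BD D B ℓ₀ (disjList [conjList ((rowList E).map parityForm),
      neg (PropForm.ofCNF (sumEncoding 1 E))])) :
    ∀ k : ℕ, BD D B (ℓ₀ + (derived E L k).length * stepLines P Q (2 * w))
      (disjList [conjList ((state E L k).map parityForm), neg (PropForm.ofCNF (sumEncoding 1 E))]) := by
  have hΦ : (neg (PropForm.ofCNF (sumEncoding 1 E))).dd ≤ 6 := (dd_neg_ofCNF_le _).trans (by norm_num)
  -- uniform facts about members of any state
  have hMdd : ∀ k, ∀ X ∈ (state E L k).map parityForm, X.dd ≤ 3 := by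
    intro k X hX
    obtain ⟨q, -, rfl⟩ := List.mem_map.1 hX
    exact dd_parityForm_le q
  have hMsize : ∀ k, ∀ X ∈ (state E L k).map parityForm, X.size ≤ P := by
    intro k X hX
    obtain ⟨q, hq, rfl⟩ := List.mem_map.1 hX
    exact (size_parityForm_le_of_le (card_supp_le_of_mem_state hw hE hq)).trans hP
  have hMlen : ∀ k, ((state E L k).map parityForm).length + 1 ≤ Q := by
    intro k
    rw [List.length_map, state, List.length_append, length_rowList]
    have := length_derived_le hw k (E := E)
    omega
  intro k
  induction k with
  | zero =>
    have e0 : state E L 0 = rowList E := by simp [state, derived]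
    rw [e0]
    simpa [derived] using h0
  | succ k ih =>
    by_cases hk : k < t + 1
    swap
    · rw [state, derived_succ_of_le (not_lt.1 hk)] at ⊢; exact ih
    by_cases hmem : L ⟨k, hk⟩ ∈ state E L k
    · rw [state, derived_succ_of_mem hk hmem]; exact ih
    -- a genuinely new line
    have hst : state E L (k + 1) = L ⟨k, hk⟩ :: state E L k := by
      rw [state, derived_succ_of_not_mem hk hmem, List.cons_append, ← state]
    have hlen : (derived E L (k + 1)).length = (derived E L k).length + 1 := by
      rw [derived_succ_of_not_mem hk hmem, List.length_cons]
    rw [hst, hlen, List.map_cons, Nat.succ_mul, ← Nat.add_assoc]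
    set i : Fin (t + 1) := ⟨k, hk⟩ with hi
    have hCdd : (parityForm (L i)).dd ≤ 3 := dd_parityForm_le _
    have hCsize : (parityForm (L i)).size ≤ P :=
      (size_parityForm_le_of_le ((hw i).trans (Nat.le_add_right _ _))).trans hP
    -- the premises of the new line
    rcases hL i with ⟨e, he⟩ | ⟨j, hj, a, ha⟩ | ⟨j, j', hj, hj', hjj⟩
    · -- an axiom line is a row, already in the state
      exact absurd (he ▸ row_mem_state k e) hmem
    · -- a scalar multiple of the earlier line `L j`
      have hjmem : parityForm (L j) ∈ (state E L k).map parityForm :=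
        List.mem_map.2 ⟨L j, line_mem_state k j (Fin.lt_def.1 hj), rfl⟩
      have hsupp : (L i).supp ⊆ (L j).supp := by rw [ha]; exact LinEqMod.supp_smul_subset a (L j)
      refine chainLocalS (varList (L j).supp) (nodup_varList _) ?_ (hMdd k) (hMsize k) (hMlen k)
        hjmem hjmem hCdd hCsize ?_ ?_ ?_ ?_ hΦ hΦB ih hD hB
      · rw [length_varList]; have := hw j; omega
      · exact fun x hx => mem_varList_of_mem_vars_parityForm hsupp hx
      · exact fun x hx => mem_varList_of_mem_vars_parityForm subset_rfl hx
      · exact fun x hx => mem_varList_of_mem_vars_parityForm subset_rfl hx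
      · intro τ h1 _
        rw [eval_parityForm_eq_true_iff] at h1 ⊢
        rw [ha]
        exact h1.smul a
    · -- the sum of the earlier lines `L j`, `L j'`
      have hjmem : parityForm (L j) ∈ (state E L k).map parityForm :=
        List.mem_map.2 ⟨L j, line_mem_state k j (Fin.lt_def.1 hj), rfl⟩
      have hj'mem : parityForm (L j') ∈ (state E L k).map parityForm :=
        List.mem_map.2 ⟨L j', line_mem_state k j' (Fin.lt_def.1 hj'), rfl⟩
      have hsupp : (L i).supp ⊆ (L j).supp ∪ (L j').supp := by
        rw [hjj]; exact LinEqMod.supp_add_subset (L j) (L j')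
      refine chainLocalS (varList ((L j).supp ∪ (L j').supp)) (nodup_varList _) ?_ (hMdd k)
        (hMsize k) (hMlen k) hjmem hj'mem hCdd hCsize ?_ ?_ ?_ ?_ hΦ hΦB ih hD hB
      · rw [length_varList]
        have h1 := hw j; have h2 := hw j'
        have := Finset.card_union_le (L j).supp (L j').supp
        omega
      · exact fun x hx => mem_varList_of_mem_vars_parityForm hsupp hx
      · exact fun x hx => mem_varList_of_mem_vars_parityForm subset_union_left hx
      · exact fun x hx => mem_varList_of_mem_vars_parityForm subset_union_right hx
      · intro τ h1 h2
        rw [eval_parityForm_eq_true_iff] at h1 h2 ⊢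
        rw [hjj]
        exact h1.add h2

/-- **A Gaussian refutation becomes a bounded refutation.** If moreover the last line of `L` is
the contradiction `0 = 1` (whose parity DNF is `⊥`), then `¬F` itself has a bounded derivation
with `ℓ₀ + 2 (n+1)^w · stepLines P Q (2w) + 126 Q + 3000` lines. [cite: GalesiEtAl2023, §4] -/
theorem refuteS (hL : IsGaussianRefutation E L) (hw : ∀ i, (L i).supp.card ≤ w)
    (hE : ∀ e, (E e).supp.card ≤ ℓ) (hP : 2 ^ (w + ℓ) * (3 * (w + ℓ) + 2) + 1 ≤ P)
    (hQ : m + 2 * (n + 1) ^ w + 1 ≤ Q) (hD : 16 ≤ D)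
    (hB : 128 * (Q * (P + 1) + 1) + 40 * (2 * w) + 600 ≤ B)
    (hΦB : 8 * (neg (PropForm.ofCNF (sumEncoding 1 E))).size ≤ B)
    (h0 : BD D B ℓ₀ (disjList [conjList ((rowList E).map parityForm),
      neg (PropForm.ofCNF (sumEncoding 1 E))])) :
    BD D B (ℓ₀ + 2 * (n + 1) ^ w * stepLines P Q (2 * w) + 126 * Q + 3000)
      (neg (PropForm.ofCNF (sumEncoding 1 E))) := by
  obtain ⟨hLd, hlast⟩ := hL
  have hΦ : (neg (PropForm.ofCNF (sumEncoding 1 E))).dd ≤ 6 := (dd_neg_ofCNF_le _).trans (by norm_num)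
  have hJ := chainS hLd hw hE hP hQ hD hB hΦB h0 (t + 1)
  have hbot : const false ∈ (state E L (t + 1)).map parityForm := by
    refine List.mem_map.2 ⟨L (Fin.last t), line_mem_state (t + 1) (Fin.last t) (by simp), ?_⟩
    rw [hlast]; exact parityForm_zero_one
  have hMdd : ∀ X ∈ (state E L (t + 1)).map parityForm, X.dd ≤ 3 := by
    intro X hX
    obtain ⟨q, -, rfl⟩ := List.mem_map.1 hX
    exact dd_parityForm_le q
  have hMsize : ∀ X ∈ (state E L (t + 1)).map parityForm, X.size ≤ P := by
    intro X hX
    obtain ⟨q, hq, rfl⟩ := List.mem_map.1 hX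
    exact (size_parityForm_le_of_le (card_supp_le_of_mem_state hw hE hq)).trans hP
  have hlenD := length_derived_le hw (t + 1) (E := E)
  have hMlen : ((state E L (t + 1)).map parityForm).length ≤ Q := by
    rw [List.length_map, state, List.length_append, length_rowList]
    omega
  have hmono : ℓ₀ + (derived E L (t + 1)).length * stepLines P Q (2 * w) ≤
      ℓ₀ + 2 * (n + 1) ^ w * stepLines P Q (2 * w) :=
    Nat.add_le_add_left (Nat.mul_le_mul_right _ hlenD) _
  have fin := chainFinalS hMdd hMsize hMlen hbot hΦ hΦB (hJ.mono hmono) hD (by omega)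
  exact fin

end Chain

end GaussFrege

end Literature.Computability.MetaComplexity
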